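import Literature.NumberTheory.EllipticCurves.TateFormOfJ
import HarnessLib

/-!
# Curves with the same `j ≠ 0, 1728`: an isomorphism over `L̄` and its Galois behaviour

`Proofs` file (theorems only, no definitions, no named facts), topic `NumberTheory/EllipticCurves`.
Refinement of `exists_addEquiv_baseChange_x_affine_of_j_eq` (`TateFormOfJ`): two elliptic curves
`E, E'` over a field `F` of characteristic `0` with `j(E) = j(E') ∉ {0, 1728}` become isomorphic
over an algebraically closed `L ⊇ F` by the composite of changes of variables defined over `F`
with the scaling `(x, y) ↦ (u⁻²x, u⁻³y)`, `u² = d ∈ F` (Silverman, *AEC*, III.1.4(b), X.5.4):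
`E'` is the quadratic twist of `E` by `d`.  Hence for `σ ∈ Aut(L/F)` one has `σ(u) = ±u` and

  `e(P^σ) = ε(σ) · e(P)^σ`,  `ε(σ) = σ(u)/u ∈ {±1}`

(`exists_addEquiv_baseChange_of_j_eq_map_algEquiv`): the isomorphism `e : E(L) ≃+ E'(L)` is
`Aut(L/F(u))`-equivariant and anti-equivariant for the automorphisms moving `u`.  In particular
`e` intertwines `σ²` for every `σ` (`…_map_algEquiv_sq`).  Consumer: the multiplicative-above-`ℓ`
case of Faltings' Satz 4 / Serre IV.2.2 (transport of torsion to the Tate form of invariant `j`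
over `K_v`, `PotentiallyMultiplicativeRamifiedTorsion`).

## References

* [SilvermanAEC2009] J. H. Silverman, *The Arithmetic of Elliptic Curves*, 2nd ed.,
  Prop. III.1.4(b), III.1 Table 3.1, X.5.4 and Cor. X.5.4.1.
-/

noncomputable section

namespace Literature.NumberTheory.EllipticCurves

-- `_root_`: some import closures declare `Literature.NumberTheory.EllipticCurves.WeierstrassCurve.*`
open _root_.WeierstrassCurve

universe u v

variable {F : Type u} [Field F]

/-- On a Weierstrass curve with `a₁ = a₃ = 0`, `-(x, y) = (x, -y)`. [Silverman AEC III.2.3]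
[folklore] -/
theorem neg_some_of_a₁_a₃ {W : WeierstrassCurve F} (h1 : W.a₁ = 0) (h3 : W.a₃ = 0) {x y : F}
    (h : W.toAffine.Nonsingular x y) (h' : W.toAffine.Nonsingular x (-y)) :
    -Affine.Point.some x y h = Affine.Point.some x (-y) h' := by
  rw [Affine.Point.neg_some, Affine.Point.some.injEq]
  refine ⟨rfl, ?_⟩
  rw [Affine.negY, show W.toAffine.a₁ = W.a₁ from rfl, show W.toAffine.a₃ = W.a₃ from rfl, h1, h3]
  ring

variable [CharZero F] (E E' : WeierstrassCurve F) [E.IsElliptic] [E'.IsElliptic]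
  (L : Type v) [Field L] [Algebra F L] [IsAlgClosed L] [DecidableEq L]

/-- **The isomorphism of two curves with the same `j ≠ 0, 1728` and the Galois action.**  Let
`E, E'` be elliptic curves over a field `F` of characteristic `0` with `j(E) = j(E') ∉ {0, 1728}`
and `L ⊇ F` algebraically closed.  There are an isomorphism of groups `e : E(L) ≃+ E'(L)` and
`u ∈ Lˣ` with `u² ∈ F` such that for every `σ ∈ Aut(L/F)`: `σ(u) = ±u`, and
`e(P^σ) = e(P)^σ` if `σ(u) = u`, `e(P^σ) = -e(P)^σ` if `σ(u) = -u` — `E'` is the quadratic twist of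
`E` by `d = u²`, and `e` is the twisting isomorphism `(x, y) ↦ (u⁻²x, u⁻³y)` between short models
composed with `F`-rational changes of variables (Silverman, *AEC*, III.1.4(b), X.5.4).
[cite: SilvermanAEC2009, Prop. III.1.4(b) and X.5.4] -/
theorem exists_addEquiv_baseChange_of_j_eq_map_algEquiv (heq : E.j = E'.j) (h0 : E.j ≠ 0)
    (h1728 : E.j ≠ 1728) :
    ∃ (e : (E.baseChange L).toAffine.Point ≃+ (E'.baseChange L).toAffine.Point) (u : L),
      u ≠ 0 ∧ u ^ 2 ∈ Set.range (algebraMap F L) ∧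
      ∀ σ : L ≃ₐ[F] L, (σ u = u ∨ σ u = -u) ∧
        ∀ P : (E.baseChange L).toAffine.Point,
          e (Affine.Point.map (σ : L →ₐ[F] L) P) =
            if σ u = u then Affine.Point.map (σ : L →ₐ[F] L) (e P)
            else -Affine.Point.map (σ : L →ₐ[F] L) (e P) := by
  letI : Invertible (2 : F) := invertibleOfNonzero two_ne_zero
  letI : Invertible (3 : F) := invertibleOfNonzero (by norm_num)
  obtain ⟨C₁, hC₁⟩ := E.exists_variableChange_isShortNF
  obtain ⟨C₂, hC₂⟩ := E'.exists_variableChange_isShortNF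
  have hj₁ : (C₁ • E).j = (C₂ • E').j := by rw [variableChange_j, variableChange_j, heq]
  have h0₁ : (C₁ • E).j ≠ 0 := by rwa [variableChange_j]
  have h1728₁ : (C₁ • E).j ≠ 1728 := by rwa [variableChange_j]
  set E₁ := C₁ • E with hE₁
  set E₂ := C₂ • E' with hE₂
  have h0₂ : E₂.j ≠ 0 := hj₁ ▸ h0₁
  have h1728₂ : E₂.j ≠ 1728 := hj₁ ▸ h1728₁
  have ha₄ : E₁.a₄ ≠ 0 := a₄_ne_zero_of_isShortNF h0₁
  have ha₆ : E₁.a₆ ≠ 0 := a₆_ne_zero_of_isShortNF h1728₁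
  have ha₄' : E₂.a₄ ≠ 0 := a₄_ne_zero_of_isShortNF h0₂
  have ha₆' : E₂.a₆ ≠ 0 := a₆_ne_zero_of_isShortNF h1728₂
  have hrel := a₄_pow_mul_a₆_sq_eq_of_j_eq hj₁
  -- the twisting parameter `d ∈ F` and its square root `u ∈ L`
  set d : F := E₁.a₆ / E₂.a₆ / (E₁.a₄ / E₂.a₄) with hd
  have hd0 : d ≠ 0 := by
    simp only [hd]
    exact div_ne_zero (div_ne_zero ha₆ ha₆') (div_ne_zero ha₄ ha₄')
  obtain ⟨u, hu⟩ := IsAlgClosed.exists_pow_nat_eq (algebraMap F L d) two_pos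
  have hu0 : u ≠ 0 := by
    rintro rfl
    rw [zero_pow two_ne_zero, eq_comm, map_eq_zero] at hu
    exact hd0 hu
  set f := algebraMap F L with hf
  have hu4 : u ^ 4 = f E₁.a₄ / f E₂.a₄ := by
    rw [pow_mul u 2 2, hu, hd]
    simp only [map_div₀]
    have : f E₂.a₄ ≠ 0 := (map_ne_zero f).mpr ha₄'
    have : f E₂.a₆ ≠ 0 := (map_ne_zero f).mpr ha₆'
    have : f E₁.a₄ ≠ 0 := (map_ne_zero f).mpr ha₄
    field_simp
    have := congrArg f hrel
    simp only [map_mul, map_pow] at this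
    linear_combination -this
  have hu6 : u ^ 6 = f E₁.a₆ / f E₂.a₆ := by
    rw [show u ^ 6 = u ^ 4 * u ^ 2 by ring, hu4, hu, hd]
    simp only [map_div₀]
    have : f E₂.a₄ ≠ 0 := (map_ne_zero f).mpr ha₄'
    have : f E₂.a₆ ≠ 0 := (map_ne_zero f).mpr ha₆'
    have : f E₁.a₄ ≠ 0 := (map_ne_zero f).mpr ha₄
    field_simp
  -- the scaling `D = ⟨u, 0, 0, 0⟩` carries `(E₁)_L` to `(E₂)_L`
  set D : VariableChange L := ⟨Units.mk0 u hu0, 0, 0, 0⟩ with hD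
  haveI hE₁L : (E₁.baseChange L).IsShortNF := by
    simp only [WeierstrassCurve.baseChange]
    constructor <;> simp [a₂_of_isShortNF]
  haveI hE₂L : (E₂.baseChange L).IsShortNF := by
    simp only [WeierstrassCurve.baseChange]
    constructor <;> simp [a₂_of_isShortNF]
  have hDE : D • E₁.baseChange L = E₂.baseChange L := by
    ext
    · simp [variableChange_a₁, hD]
    · simp [variableChange_a₂, a₂_of_isShortNF, hD]
    · simp [variableChange_a₃, hD]
    · simp only [variableChange_a₄, a₁_of_isShortNF, a₂_of_isShortNF, a₃_of_isShortNF, hD,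
        Units.val_inv_eq_inv_val, Units.val_mk0, mul_zero, sub_zero, add_zero]
      rw [show (E₁.baseChange L).a₄ = f E₁.a₄ from rfl,
        show (E₂.baseChange L).a₄ = f E₂.a₄ from rfl, inv_pow, hu4]
      have : f E₁.a₄ ≠ 0 := (map_ne_zero f).mpr ha₄
      field_simp
      ring
    · simp only [variableChange_a₆, a₁_of_isShortNF, a₂_of_isShortNF, a₃_of_isShortNF, hD,
        Units.val_inv_eq_inv_val, Units.val_mk0, mul_zero, sub_zero, add_zero]
      rw [show (E₁.baseChange L).a₆ = f E₁.a₆ from rfl,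
        show (E₂.baseChange L).a₆ = f E₂.a₆ from rfl, inv_pow, hu6]
      have : f E₁.a₆ ≠ 0 := (map_ne_zero f).mpr ha₆
      field_simp
      ring
  -- the composite isomorphism
  set e₁ := VariableChange.pointEquivBaseChange E C₁ L with he₁
  set e₂ := (VariableChange.pointEquiv (E₁.baseChange L) D).trans (Affine.Point.congrEquiv hDE)
    with he₂
  set e₄ := VariableChange.pointEquivBaseChange E' C₂ L with he₄
  have he₂_some : ∀ (x y : L) (h : (E₁.baseChange L).toAffine.Nonsingular x y),
      ∃ h', e₂ (.some x y h) = .some (D.toX x) (D.toY x y) h' := fun x y h ↦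
    ⟨hDE ▸ (VariableChange.nonsingular_iff _ D x y).mpr h, by
      rw [he₂, AddEquiv.trans_apply, VariableChange.pointEquiv_some,
        Affine.Point.congrEquiv_some]⟩
  have hDX : ∀ x : L, D.toX x = (u⁻¹) ^ 2 * x := fun x ↦ by
    simp [VariableChange.toX_def, hD]
  have hDY : ∀ x y : L, D.toY x y = (u⁻¹) ^ 3 * y := fun x y ↦ by
    simp [VariableChange.toY_def, hD]
  -- `u² ∈ F`, so `σ u = ±u`
  have hu2 : u ^ 2 ∈ Set.range (algebraMap F L) := ⟨d, hu.symm⟩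
  have hσu : ∀ σ : L ≃ₐ[F] L, σ u = u ∨ σ u = -u := fun σ ↦ by
    have h2 : σ u ^ 2 = u ^ 2 := by rw [← map_pow, hu, AlgEquiv.commutes]
    have : (σ u - u) * (σ u + u) = 0 := by linear_combination h2
    rcases mul_eq_zero.mp this with h | h
    · exact Or.inl (sub_eq_zero.mp h)
    · exact Or.inr (eq_neg_of_add_eq_zero_left h)
  -- the behaviour of `e₂` under `σ`
  have he₂σ : ∀ (σ : L ≃ₐ[F] L) (Q : (E₁.baseChange L).toAffine.Point),
      e₂ (Affine.Point.map (σ : L →ₐ[F] L) Q) =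
        if σ u = u then Affine.Point.map (σ : L →ₐ[F] L) (e₂ Q)
        else -Affine.Point.map (σ : L →ₐ[F] L) (e₂ Q) := by
    intro σ Q
    rcases Q with _ | ⟨x, y, h⟩
    · simp only [← Affine.Point.zero_def, map_zero, neg_zero, ite_self]
    · set σ' : L →ₐ[F] L := (σ : L →ₐ[F] L)
      obtain ⟨hσ', hmapσ⟩ : ∃ h', Affine.Point.map σ' (.some x y h) = .some (σ' x) (σ' y) h' :=
        ⟨_, Affine.Point.map_some σ' h⟩
      obtain ⟨h₂, he₂P⟩ := he₂_some x y h
      obtain ⟨h₂σ, he₂σP⟩ := he₂_some (σ' x) (σ' y) hσ'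
      obtain ⟨h₃, hmap₃⟩ : ∃ h', Affine.Point.map σ' (.some (D.toX x) (D.toY x y) h₂) =
          .some (σ' (D.toX x)) (σ' (D.toY x y)) h' := ⟨_, Affine.Point.map_some σ' h₂⟩
      rw [hmapσ, he₂σP, he₂P, hmap₃]
      have hσinv : σ' u⁻¹ = (σ u)⁻¹ := map_inv₀ σ u
      have hX : D.toX (σ' x) = σ' (D.toX x) := by
        rw [hDX, hDX, map_mul, map_pow, hσinv]
        rcases hσu σ with h | h
        · rw [show σ u = u from h]
        · rw [show σ u = -u from h, inv_neg, neg_sq]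
      split_ifs with hfix
      · rw [Affine.Point.some.injEq]
        refine ⟨hX, ?_⟩
        rw [hDY, hDY, map_mul, map_pow, hσinv, show σ u = u from hfix]
      · have hneg : σ u = -u := (hσu σ).resolve_left hfix
        have hY : D.toY (σ' x) (σ' y) = -σ' (D.toY x y) := by
          rw [hDY, hDY, map_mul, map_pow, hσinv, hneg, inv_neg]
          ring
        have h₃' : (E₂.baseChange L).toAffine.Nonsingular (σ' (D.toX x)) (-σ' (D.toY x y)) := by
          rw [← hX, ← hY]; exact h₂σ
        rw [neg_some_of_a₁_a₃ (a₁_of_isShortNF (W := E₂.baseChange L))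
          (a₃_of_isShortNF (W := E₂.baseChange L)) h₃ h₃', Affine.Point.some.injEq]
        exact ⟨hX, hY⟩
  refine ⟨e₁.trans (e₂.trans e₄.symm), u, hu0, hu2, fun σ ↦ ⟨hσu σ, fun P ↦ ?_⟩⟩
  have key : ∀ Q, (e₁.trans (e₂.trans e₄.symm)) Q = e₄.symm (e₂ (e₁ Q)) := fun Q ↦ rfl
  rw [key, key, he₁, VariableChange.pointEquivBaseChange_map_algEquiv, he₂σ]
  split_ifs with hfix
  · rw [he₄, ← VariableChange.pointEquivBaseChange_symm_map]
  · rw [map_neg, he₄, ← VariableChange.pointEquivBaseChange_symm_map]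

/-- **The isomorphism intertwines squares**: with `e` as in
`exists_addEquiv_baseChange_of_j_eq_map_algEquiv`, `e(P^{σ²}) = e(P)^{σ²}` for every
`σ ∈ Aut(L/F)` (`ε(σ²) = ε(σ)² = 1`). [cite: SilvermanAEC2009, X.5.4] -/
theorem exists_addEquiv_baseChange_of_j_eq_map_algEquiv_sq (heq : E.j = E'.j) (h0 : E.j ≠ 0)
    (h1728 : E.j ≠ 1728) :
    ∃ e : (E.baseChange L).toAffine.Point ≃+ (E'.baseChange L).toAffine.Point,
      ∀ (σ : L ≃ₐ[F] L) (P : (E.baseChange L).toAffine.Point),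
        e (Affine.Point.map ((σ * σ : L ≃ₐ[F] L) : L →ₐ[F] L) P) =
          Affine.Point.map ((σ * σ : L ≃ₐ[F] L) : L →ₐ[F] L) (e P) := by
  obtain ⟨e, u, -, -, he⟩ :=
    exists_addEquiv_baseChange_of_j_eq_map_algEquiv E E' L heq h0 h1728
  refine ⟨e, fun σ P ↦ ?_⟩
  have hfix : (σ * σ) u = u := by
    rw [AlgEquiv.mul_apply]
    rcases (he σ).1 with h | h
    · rw [h, h]
    · rw [h, map_neg, h, neg_neg]
  rw [(he (σ * σ)).2 P, if_pos hfix]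

end Literature.NumberTheory.EllipticCurves

end
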